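import Summits.Ventures.Crystal3D.Theorems.StickyWulffConstantTextureLiminfTexShadowLevelReachBornChains
import Summits.Ventures.Crystal3D.Theorems.StickyWulffConstantGenericWallFloorLineTops
import Summits.Ventures.Crystal3D.Theorems.StickyWulffConstantGenericWallFloorMixedDozenRules
import HarnessLib

/-!
# BORN FLUX-TO-AREA: a complete band of a lamella's lattice carries `√2·|⟪c, e₃⟫|·π ρ² − O(ρ)` lines of class `c`, each with its own launch below it
# (lane T, crux `TextureLiminfV5`, stmt-Ventures-23912, registered stub `stub_terraceCensus`; (β) assembly RESUME (d′) «born supply», geometric half; cf-p1 (cccxxvi)(B))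

HONEST FRAMING. Venture `Summits/Ventures/Crystal3D` (cell `crystal3d-full`), route `route-Ventures-StickyWulffConstant`, helper `--supports` the
law-v5 crux `TextureLiminfV5` (stmt-Ventures-23912), lane T, mechanism (β).  Lattice-line counting + the chain bottoms of …LevelReachBornChains; standard axioms;
census-free, certificate-free; nothing about energies; F-C1 not moved.

THE POINT.  The born censuses (`born_barlow_endPairs` & co.) bound the born LAUNCHES of a lamella family from above by payers + cuts + rims; the born SUPPLY
law needs them bounded from BELOW.  19480-p1's …BornChains gives the counting half («launches = chain bottoms; ≤ K trackable balls per launch»).  This file is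
the AREA half, in the envelope currency of BETA-CUT-g22 §4(c) / PRESENTABLE-SUPPLY-g24 («weight √2·|⟪c, e₃⟫| per direction per unit footprint»): if the lamella
carries a COMPLETE horizontal band of its lattice `A·Λ₀ + t` (height `R ≥ 1`, radius `ρ`) all of whose balls are trackable, then
* **`bottoms_ge_lineCount`** — the run BOTTOMS of class `w` in the band sample `P` (`p ∈ P`, `p − A w ∉ P`) number `≥ √2·|⟪A w, e₃⟫|·π·ρ² − 10·√2·π·ρ`
  (lane G's `tops_ge_lineCount` for the slot `−w`: one bottom per lattice line meeting the convex sample);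
* `sample_sub_slot_mem` — convexity bookkeeping: a lattice point `p' − A w` between two sample points `p = b + k·Aw`, `p' = b + k'·Aw` (`k < k'`) of one line is in the sample;
* **`card_launches_ge_lineCount`** — for ANY predicate `Tr` supported on the finite `X` with every ball of `P` trackable and `(A w)₂ > 0`: the LAUNCHES
  `{b ∈ X : Tr b ∧ ¬ Tr (b − A w)}` number `≥ √2·|⟪A w, e₃⟫|·π·ρ² − 10·√2·π·ρ` — below each bottom of `P` sits the bottom of its `Tr`-chain (`exists_chain_bottom`),
  and distinct bottoms of `P` have distinct chain bottoms (two bottoms of `P` on one line would put the upper one's predecessor inside the convex sample).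
So «#born-or-moving launches of the lamella ≥ √2·c₂·(footprint) − rim» is a theorem the moment the assembly exhibits the complete trackable band (slab pinning /
τ = 1 of the envelope); which launches are BORN (predecessor present, not trackable) and which are vacancy-born is the census side's split (`born_…` vs `bornMoving_…`).
WHAT THIS IS NOT: the existence of the complete band (pinning), the census, the pooling, any certificate; F-C1 not moved.
-/

noncomputable section

namespace Summit.Ventures.Crystal3D.Theorems

open Summit.Ventures.Crystal3D Finset
open Literature.MathematicalPhysics.StatisticalMechanics (fccStacking)
open Summit.Ventures.Crystal3D.Cruxes.TextureLiminf.TexShadow (E3)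
open scoped InnerProductSpace

/-- **Run bottoms of one class inside a complete band sample** (`tops_ge_lineCount` for `−w`). -/
theorem bottoms_ge_lineCount (A : E3 ≃ₗᵢ[ℝ] E3) (t : E3) (a R ρ : ℝ) (hR : 1 ≤ R) (hρ : R ≤ ρ) (P : Finset E3)
    (hP : ∀ p, p ∈ P ↔ (p ∈ (fun q => A q + t) '' fccStacking 1 (Real.sqrt (2 / 3)) ∧
      a ≤ p 2 ∧ p 2 ≤ a + R ∧ p 0 ^ 2 + p 1 ^ 2 ≤ ρ ^ 2))
    {w : E3} (hw : w ∈ fccSlots) :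
    Real.sqrt 2 * |⟪A w, EuclideanSpace.single (2 : Fin 3) (1 : ℝ)⟫_ℝ| * Real.pi * ρ ^ 2 - 10 * Real.sqrt 2 * Real.pi * ρ ≤
      ((P.filter fun p => p - A w ∉ P).card : ℝ) := by
  classical
  obtain ⟨Ea, Eb, hEa, hEb, hdet, hframe, -⟩ := exists_frame_of_mem_fccSlots (neg_mem_fccSlots hw)
  have h := tops_ge_lineCount A t a R ρ hR hρ P hP Ea Eb (-w) hEa hEb (by rw [norm_neg, norm_eq_one_of_mem_fccSlots hw]) hdet hframe
  have hfilter : (P.filter fun p => p + A (-w) ∉ P) = P.filter fun p => p - A w ∉ P := by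
    refine filter_congr fun p _ => ?_
    rw [map_neg, ← sub_eq_add_neg]
  rw [hfilter, map_neg, inner_neg_left, abs_neg] at h
  exact h

/-- **Convexity bookkeeping**: if `p = b + k·c` and `p' = b + k'·c` (`k < k'`) are both in the band sample, then so is the lattice point `p' − c`
(`c = A w` a slot of the moved lattice). -/
theorem sample_sub_slot_mem (A : E3 ≃ₗᵢ[ℝ] E3) (t : E3) (a R ρ : ℝ) (P : Finset E3)
    (hP : ∀ p, p ∈ P ↔ (p ∈ (fun q => A q + t) '' fccStacking 1 (Real.sqrt (2 / 3)) ∧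
      a ≤ p 2 ∧ p 2 ≤ a + R ∧ p 0 ^ 2 + p 1 ^ 2 ≤ ρ ^ 2))
    {w : E3} (hw : w ∈ fccSlots) (hc : 0 < (A w) 2) {b p p' : E3} {k k' : ℕ} (hkk' : k < k')
    (hp : p ∈ P) (hp' : p' ∈ P) (hpb : p = b + (k : ℝ) • A w) (hp'b : p' = b + (k' : ℝ) • A w) :
    p' - A w ∈ P := by
  obtain ⟨⟨q', hq', hpq'⟩, ha', hb', hlat'⟩ := (hP p').1 hp'
  obtain ⟨-, ha, -, hlat⟩ := (hP p).1 hp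
  have hpq'' : A q' + t = p' := hpq'
  refine (hP _).2 ⟨⟨q' + -w, add_mem_fcc_of_mem_fccSlots hq' (neg_mem_fccSlots hw), ?_⟩, ?_, ?_, ?_⟩
  · show A (q' + -w) + t = p' - A w
    rw [map_add, map_neg, ← hpq'']; abel
  · -- height: `(p' − c)₂ = b₂ + (k' − 1) c₂ ≥ b₂ + k c₂ = p₂ ≥ a`
    have hk : (k : ℝ) ≤ (k' : ℝ) - 1 := by
      have : k + 1 ≤ k' := hkk'
      have : ((k + 1 : ℕ) : ℝ) ≤ (k' : ℝ) := by exact_mod_cast this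
      push_cast at this; linarith
    have e1 : (p' - A w) 2 = b 2 + ((k' : ℝ) - 1) * (A w) 2 := by
      rw [PiLp.sub_apply, hp'b, PiLp.add_apply, PiLp.smul_apply, smul_eq_mul]; ring
    have e2 : p 2 = b 2 + (k : ℝ) * (A w) 2 := by rw [hpb, PiLp.add_apply, PiLp.smul_apply, smul_eq_mul]
    rw [e1]; nlinarith [mul_le_mul_of_nonneg_right hk hc.le]
  · have : (p' - A w) 2 = p' 2 - (A w) 2 := by rw [PiLp.sub_apply]
    rw [this]; linarith
  · -- lateral: `p' − c = (1 − λ) p + λ p'` with `λ = (k' − 1 − k)/(k' − k) ∈ [0, 1]`, and the squared lateral radius is convex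
    have hd : (0 : ℝ) < (k' : ℝ) - k := by
      have : ((k : ℕ) : ℝ) < (k' : ℝ) := by exact_mod_cast hkk'
      linarith
    set lam : ℝ := ((k' : ℝ) - 1 - k) / ((k' : ℝ) - k) with hlam
    have hlam0 : 0 ≤ lam := by
      rw [hlam]; refine div_nonneg ?_ hd.le
      have : k + 1 ≤ k' := hkk'
      have : ((k + 1 : ℕ) : ℝ) ≤ (k' : ℝ) := by exact_mod_cast this
      push_cast at this; linarith
    have hlam1 : lam ≤ 1 := by rw [hlam, div_le_one hd]; linarith
    have hcoord : ∀ i : Fin 3, (p' - A w) i = (1 - lam) * p i + lam * p' i := by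
      intro i
      rw [PiLp.sub_apply, hpb, hp'b, PiLp.add_apply, PiLp.add_apply, PiLp.smul_apply, PiLp.smul_apply, smul_eq_mul, smul_eq_mul]
      have : lam * ((k' : ℝ) - k) = (k' : ℝ) - 1 - k := by rw [hlam]; field_simp
      linear_combination (-(A w) i) * this
    rw [hcoord 0, hcoord 1]
    have hconv : ∀ u v : ℝ, ((1 - lam) * u + lam * v) ^ 2 ≤ (1 - lam) * u ^ 2 + lam * v ^ 2 := by
      intro u v; nlinarith [mul_nonneg hlam0 (sub_nonneg.2 hlam1), sq_nonneg (u - v)]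
    nlinarith [hconv (p 0) (p' 0), hconv (p 1) (p' 1), mul_nonneg (sub_nonneg.2 hlam1) (by positivity : (0:ℝ) ≤ p 0 ^ 2 + p 1 ^ 2)]

open scoped Classical in
/-- **BORN FLUX-TO-AREA (launches per complete band).**  See the module docstring: `Tr` any predicate supported on the finite `X`; the class `c = A w`
rises; `P` = the complete band sample of the moved lattice (height `R ≥ 1`, radius `ρ ≥ R`), every ball of which is trackable.  Then the launches of
`Tr`-chains number at least `√2·|⟪A w, e₃⟫|·π·ρ² − 10·√2·π·ρ`. -/
theorem card_launches_ge_lineCount {X : Finset E3} (Tr : E3 → Prop) (hTrX : ∀ q, Tr q → q ∈ X)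
    (A : E3 ≃ₗᵢ[ℝ] E3) (t : E3) {w : E3} (hw : w ∈ fccSlots) (hc : 0 < (A w) 2)
    (a R ρ : ℝ) (hR : 1 ≤ R) (hρ : R ≤ ρ) (P : Finset E3)
    (hP : ∀ p, p ∈ P ↔ (p ∈ (fun q => A q + t) '' fccStacking 1 (Real.sqrt (2 / 3)) ∧
      a ≤ p 2 ∧ p 2 ≤ a + R ∧ p 0 ^ 2 + p 1 ^ 2 ≤ ρ ^ 2))
    (hPTr : ∀ p ∈ P, Tr p) :
    Real.sqrt 2 * |⟪A w, EuclideanSpace.single (2 : Fin 3) (1 : ℝ)⟫_ℝ| * Real.pi * ρ ^ 2 - 10 * Real.sqrt 2 * Real.pi * ρ ≤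
      ((X.filter fun b => Tr b ∧ ¬ Tr (b - A w)).card : ℝ) := by
  set c : E3 := A w with hcdef
  set Bot : Finset E3 := P.filter fun p => p - c ∉ P with hBot
  set L : Finset E3 := X.filter fun b => Tr b ∧ ¬ Tr (b - c) with hL
  -- the chain bottom below a trackable ball
  have hex : ∀ p ∈ P, ∃ k : ℕ, (∀ j : ℕ, j ≤ k → Tr (p - (j : ℝ) • c)) ∧ ¬ Tr (p - ((k : ℝ) + 1) • c) :=
    fun p hp => exists_chain_bottom Tr c hTrX hc (hPTr p hp)
  set f : E3 → E3 := fun p => if hp : p ∈ P then p - ((Classical.choose (hex p hp) : ℕ) : ℝ) • c else p with hf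
  have hfspec : ∀ p (hp : p ∈ P), f p = p - ((Classical.choose (hex p hp) : ℕ) : ℝ) • c ∧
      (∀ j : ℕ, j ≤ Classical.choose (hex p hp) → Tr (p - (j : ℝ) • c)) ∧
      ¬ Tr (p - (((Classical.choose (hex p hp) : ℕ) : ℝ) + 1) • c) := by
    intro p hp
    refine ⟨by rw [hf]; simp only [dif_pos hp], (Classical.choose_spec (hex p hp)).1, (Classical.choose_spec (hex p hp)).2⟩
  -- `f` maps bottoms to launches
  have hmaps : ∀ p ∈ Bot, f p ∈ L := by
    intro p hp
    have hpP : p ∈ P := (mem_filter.1 hp).1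
    obtain ⟨hfp, hchain, hstop⟩ := hfspec p hpP
    set k := Classical.choose (hex p hpP) with hk
    have hTb : Tr (f p) := by rw [hfp]; exact hchain k le_rfl
    have hnot : ¬ Tr (f p - c) := by
      rw [hfp, show p - ((k : ℕ) : ℝ) • c - c = p - (((k : ℕ) : ℝ) + 1) • c by rw [add_smul, one_smul, sub_sub]]
      exact hstop
    exact mem_filter.2 ⟨hTrX _ hTb, hTb, hnot⟩
  -- `f` is injective on bottoms: two bottoms of `P` on one line put the upper one's predecessor inside the convex sample
  have hinj : Set.InjOn f ↑Bot := by
    intro p hp p' hp' hff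
    have hpP : p ∈ P := (mem_filter.1 (mem_coe.1 hp)).1
    have hp'P : p' ∈ P := (mem_filter.1 (mem_coe.1 hp')).1
    have hpbot : p - c ∉ P := (mem_filter.1 (mem_coe.1 hp)).2
    have hp'bot : p' - c ∉ P := (mem_filter.1 (mem_coe.1 hp')).2
    obtain ⟨hfp, -, -⟩ := hfspec p hpP
    obtain ⟨hfp', -, -⟩ := hfspec p' hp'P
    set k := Classical.choose (hex p hpP) with hk
    set k' := Classical.choose (hex p' hp'P) with hk'
    have hpb : p = f p + ((k : ℕ) : ℝ) • c := by rw [hfp, sub_add_cancel]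
    have hp'b : p' = f p + ((k' : ℕ) : ℝ) • c := by rw [hff, hfp', sub_add_cancel]
    rcases lt_trichotomy k k' with hlt | heq | hgt
    · exact absurd (sample_sub_slot_mem A t a R ρ P hP hw hc hlt hpP hp'P hpb hp'b) hp'bot
    · rw [hpb, hp'b, heq]
    · exact absurd (sample_sub_slot_mem A t a R ρ P hP hw hc hgt hp'P hpP hp'b hpb) hpbot
  have hcard : Bot.card ≤ L.card := card_le_card_of_injOn f hmaps hinj
  have h := bottoms_ge_lineCount A t a R ρ hR hρ P hP hw
  exact h.trans (by exact_mod_cast hcard)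

end Summit.Ventures.Crystal3D.Theorems

end
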